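import Mathlib
import HarnessLib
import Literature.Analysis.FluidPDE.ClassicalLerayProjection
import Literature.Analysis.FluidPDE.CalderonSplittingLp
import Literature.Analysis.FluidPDE.NewtonKernel
import Literature.Analysis.FluidPDE.TaoEnergyLocalisationProofs
import Summits.NavierStokesRegularity.NavierStokesRegularity.Theorems.QuarterLogPincerQuietCollarShellGeometry
import Summits.NavierStokesRegularity.NavierStokesRegularity.Theorems.QuarterLogPincerQuietCollarShellPotential

/-!
# Route `QuarterLogPincer`, crux `TypeIQuantSubcubicExp` (stmt-NavierStokesRegularity-24077), line `quiet_collar` — towards QP2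
# (log-weighted typing `StubCutPairLog`), module D1: THE LERAY-PROJECTED CUT DATUM `P[χa] = χa − ∇π[χa]` AND ITS THREE BOUNDS

The datum of the cut pair is built from the Leray projection of the cut slice `χa`, `a = v(−1)` smooth and divergence-free,
`χ = radialCutoff r (r+L)` (`= 1` on `B̄(r)`, `= 0` off `B(r+L)`), `a` being `η`-quiet on the collar `{r ≤ |t| ≤ r+L}`.  This
file packages what the assembly needs about the data error `∇π[χa] = ∇Δ⁻¹(∇χ·a)`:

* `exists_cutRef_source` — the source `div(χa) = ∇χ·a`: smooth, compactly supported in `B̄(0, r+L)`, `|div(χa)| ≤ C₁η/L`,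
  vanishing off the collar;
* `exists_norm_gradient_divPotential_cutRef_le_crude` — `‖∇π[χa](x)‖ ≤ C·η·(r+L)/L` (the tree's linear-in-support bound
  `abs_fderiv_divPotential_le_of_support`; sharp when `L ≥ r`);
* `exists_norm_gradient_divPotential_cutRef_le_log` — THE UNIFORM SUP BOUND `‖∇π[χa](x)‖ ≤ C·η·(1 + log r)` for all
  `r ≥ 1`, `L ≥ 1` (M2 `exists_norm_gradient_divPotential_cutRef_le` when `L ≤ r`, the crude bound when `L ≥ r`); with the
  log-weighted collar level `η = ηq/(1 + log r)` of `QuietCollarLog` this is `≤ C·ηq`, UNIFORMLY IN `r`;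
* `exists_norm_gradient_divPotential_cutRef_far_le` — THE FAR FIELD `‖∇π[χa](x)‖ ≤ C·η·(r+L)²/‖x‖²` for `‖x‖ ≥ 2(r+L)`
  (monopole bound: kernel gradient `≤ (4π|x−t|²)⁻¹` at distance `≥ ‖x‖/2`, source mass `≤ (C₁η/L)·|shell| ≤ 3|B₁|C₁η(r+L)²`);
* `exists_eLpNorm_gradient_divPotential_cutRef_le` — THE `L³` BOUND `‖∇π[χa]‖₃ ≤ C‖1_{B(0,r+L)}a‖₃` (Riesz transforms on
  `L³`, tree `exists_eLpNorm_gradient_divPotential_le`);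
* `classicalLerayProj_cutRef_eq_neg_gradient` — off `B(r+L)` the projected datum is the pure gradient `−∇π[χa]`.

r-INDEPENDENT groundwork for QP2 (DIRECTOR-NS KEY-NS #187).  HONEST FRAME: potential theory of a cut-off field; nothing here
bears on 24077, W7 or Navier–Stokes regularity (OPEN).  pub-ns-dss typer (g37), `--supports 24077`.
-/

noncomputable section

set_option linter.dupNamespace false

namespace Summit.NavierStokesRegularity.NavierStokesRegularity.Cruxes.TypeIQuantSubcubicExp.QuietCollar

open MeasureTheory Set Function Filter Real Metric ContinuousLinearMap
open scoped ENNReal NNReal Topology Convolution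
open Literature.Analysis Literature.Analysis.FluidPDE Literature.Analysis.FluidPDE.CalderonSplittingLp

/-! ### The source `div(χa) = ∇χ·a` -/

/-- **THE SOURCE OF THE DATA ERROR**: there is an absolute `C₁ > 0` (the gradient constant of Tao's cut-off profile) such that
for every smooth divergence-free `a`, `η`-quiet on the collar `{r ≤ |t| ≤ r+L}` (`0 < r`, `0 < L`), the cut slice `χa`,
`χ = radialCutoff r (r+L)`, is smooth and compactly supported in `B̄(0,r+L)`, and its divergence `∇χ·a` is bounded by `C₁η/L`
and vanishes off the collar. [folklore] -/
theorem exists_cutRef_source :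
    ∃ C₁ : ℝ, 0 < C₁ ∧ ∀ (a : EuclideanSpace ℝ (Fin 3) → EuclideanSpace ℝ (Fin 3)) (r L η : ℝ),
      ContDiff ℝ (⊤ : ℕ∞) a → VectorCalculus.IsDivFree a → 0 < r → 0 < L → 0 ≤ η →
      (∀ t, r ≤ ‖t‖ → ‖t‖ ≤ r + L → ‖a t‖ ≤ η) →
      ContDiff ℝ (⊤ : ℕ∞) (fun y => radialCutoff r (r + L) y • a y) ∧
      HasCompactSupport (fun y => radialCutoff r (r + L) y • a y) ∧
      tsupport (fun y => radialCutoff r (r + L) y • a y) ⊆ closedBall (0 : EuclideanSpace ℝ (Fin 3)) (r + L) ∧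
      (∀ t, |VectorCalculus.divergence (fun y => radialCutoff r (r + L) y • a y) t| ≤ C₁ / L * η) ∧
      (∀ t, VectorCalculus.divergence (fun y => radialCutoff r (r + L) y • a y) t ≠ 0 → r ≤ ‖t‖ ∧ ‖t‖ ≤ r + L) := by
  obtain ⟨C₁, hC₁, hC₁b⟩ := exists_norm_fderiv_taoCutoff_le (E := EuclideanSpace ℝ (Fin 3))
  refine ⟨C₁, hC₁, ?_⟩
  intro a r L η ha hdiv hr hL hη hquiet
  have hR : 0 < r + L := by linarith
  have hrR : r < r + L := by linarith
  -- the cut-off: smooth, compactly supported, `‖∇χ‖ ≤ C₁/L`, locally constant off the collar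
  have hχs : ContDiff ℝ (⊤ : ℕ∞) (radialCutoff r (r + L) : EuclideanSpace ℝ (Fin 3) → ℝ) := radialCutoff_contDiff r (r + L)
  have hχd : ∀ t, ‖fderiv ℝ (radialCutoff r (r + L) : EuclideanSpace ℝ (Fin 3) → ℝ) t‖ ≤ C₁ / L := by
    have hw : 0 < ((r + L) ^ 2 - r ^ 2) / (r + L) := div_pos (by nlinarith) hR
    have hfun : (radialCutoff r (r + L) : EuclideanSpace ℝ (Fin 3) → ℝ) = taoCutoff (r + L) (((r + L) ^ 2 - r ^ 2) / (r + L)) :=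
      funext fun z => radialCutoff_eq_taoCutoff hR.ne' z
    intro t
    rw [hfun]
    refine (hC₁b (r + L) _ hw hR t).trans (div_le_div_of_nonneg_left hC₁.le hL ?_)
    rw [le_div_iff₀ hR]
    nlinarith
  have hχoff : ∀ t : EuclideanSpace ℝ (Fin 3), ¬ (r ≤ ‖t‖ ∧ ‖t‖ ≤ r + L) →
      fderiv ℝ (radialCutoff r (r + L) : EuclideanSpace ℝ (Fin 3) → ℝ) t = 0 := by
    intro t ht
    rcases lt_or_ge ‖t‖ r with h1 | h1
    · rw [(radialCutoff_eventuallyEq_one hr.le hrR h1).fderiv_eq, fderiv_const_apply]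
    · have h2 : r + L < ‖t‖ := lt_of_not_ge fun h => ht ⟨h1, h⟩
      rw [(radialCutoff_eventuallyEq_zero hr.le hrR h2).fderiv_eq, fderiv_const_apply]
  have hG : ContDiff ℝ (⊤ : ℕ∞) (fun y => radialCutoff r (r + L) y • a y) := hχs.smul ha
  have hGc : HasCompactSupport (fun y => radialCutoff r (r + L) y • a y) :=
    (hasCompactSupport_radialCutoff hr.le hrR).smul_right
  have hGsupp : tsupport (fun y => radialCutoff r (r + L) y • a y) ⊆ closedBall (0 : EuclideanSpace ℝ (Fin 3)) (r + L) := by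
    refine closure_minimal (fun y hy => ?_) isClosed_closedBall
    rw [mem_closedBall, dist_zero_right]
    by_contra h
    exact (mem_support.1 hy) (by rw [radialCutoff_eq_zero hr.le hrR (not_le.1 h).le, zero_smul])
  have hdivG : ∀ t, VectorCalculus.divergence (fun y => radialCutoff r (r + L) y • a y) t =
      fderiv ℝ (radialCutoff r (r + L) : EuclideanSpace ℝ (Fin 3) → ℝ) t (a t) := by
    intro t
    rw [divergence_smul_apply ((hχs.differentiable (by simp)) t) ((ha.differentiable (by simp)) t), hdiv t, mul_zero,
      zero_add, real_inner_comm, gradient, InnerProductSpace.toDual_symm_apply]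
  refine ⟨hG, hGc, hGsupp, fun t => ?_, fun t ht => ?_⟩
  · rw [hdivG]
    by_cases ht : r ≤ ‖t‖ ∧ ‖t‖ ≤ r + L
    · rw [← Real.norm_eq_abs]
      exact (le_opNorm _ _).trans (mul_le_mul (hχd t) (hquiet t ht.1 ht.2) (norm_nonneg _) (by positivity))
    · rw [hχoff t ht, zero_apply, abs_zero]; positivity
  · by_contra hcon
    exact ht (by rw [hdivG, hχoff t hcon, zero_apply])

/-! ### Sup bounds of the data error `∇π[χa]` -/

/-- **CRUDE SUP BOUND (sharp for fat collars `L ≥ r`)**: `‖∇π[χa](x)‖ ≤ C·η·(r+L)/L` for an absolute `C`, from the tree's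
linear-in-support bound `abs_fderiv_divPotential_le_of_support` (support radius `r+L`, source size `C₁η/L`). [folklore] -/
theorem exists_norm_gradient_divPotential_cutRef_le_crude :
    ∃ C : ℝ, 0 < C ∧ ∀ (a : EuclideanSpace ℝ (Fin 3) → EuclideanSpace ℝ (Fin 3)) (r L η : ℝ),
      ContDiff ℝ (⊤ : ℕ∞) a → VectorCalculus.IsDivFree a → 0 < r → 0 < L → 0 ≤ η →
      (∀ t, r ≤ ‖t‖ → ‖t‖ ≤ r + L → ‖a t‖ ≤ η) →
      ∀ x : EuclideanSpace ℝ (Fin 3),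
        ‖gradient (divPotential fun y => radialCutoff r (r + L) y • a y) x‖ ≤ C * η * ((r + L) / L) := by
  obtain ⟨C₁, hC₁, hsrc⟩ := exists_cutRef_source
  set V₁ : ℝ := (1 + (4 * Real.pi)⁻¹ * (volume : Measure (EuclideanSpace ℝ (Fin 3))).real
    (closedBall (0 : EuclideanSpace ℝ (Fin 3)) 1)) with hV₁
  have hV₁pos : 0 < V₁ := by rw [hV₁]; positivity
  refine ⟨C₁ * V₁, by positivity, ?_⟩
  intro a r L η ha hdiv hr hL hη hquiet x
  obtain ⟨hG, hGc, hGsupp, hD, -⟩ := hsrc a r L η ha hdiv hr hL hη hquiet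
  have hR : 0 < r + L := by linarith
  have hv : ∀ v, |fderiv ℝ (divPotential fun y => radialCutoff r (r + L) y • a y) x v| ≤
      ‖v‖ * (C₁ / L * η) * (V₁ * (r + L)) := fun v =>
    abs_fderiv_divPotential_le_of_support hG hGc hR hGsupp hD x v
  have h0 : 0 ≤ C₁ / L * η * (V₁ * (r + L)) := by positivity
  rw [norm_gradient_eq_norm_fderiv]
  refine (opNorm_le_bound _ h0 fun v => ?_).trans (le_of_eq ?_)
  · rw [Real.norm_eq_abs]
    calc |fderiv ℝ (divPotential fun y => radialCutoff r (r + L) y • a y) x v|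
        ≤ ‖v‖ * (C₁ / L * η) * (V₁ * (r + L)) := hv v
      _ = C₁ / L * η * (V₁ * (r + L)) * ‖v‖ := by ring
  · field_simp

/-- **THE r-UNIFORM SUP BOUND UNDER THE LOG-WEIGHTED LEVEL**: there is an absolute `C > 0` such that for every smooth
divergence-free `a`, `η`-quiet on the collar `{r ≤ |t| ≤ r+L}` with `r ≥ 1`, `L ≥ 1`, the data error obeys
`‖∇π[χa](x)‖ ≤ C·η·(1 + log r)` at EVERY `x` — the log-sharp M2 bound `C·η·(1 + log(r/L)) ≤ C·η·(1 + log r)` when `L ≤ r`,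
the crude bound `C·η·(r+L)/L ≤ 2Cη` when `L ≥ r`.  With `η = ηq/(1 + log r)` (the level delivered by `QuietCollarLog`) the
right-hand side is `C·ηq`, UNIFORMLY IN `r`. [folklore] -/
theorem exists_norm_gradient_divPotential_cutRef_le_log :
    ∃ C : ℝ, 0 < C ∧ ∀ (a : EuclideanSpace ℝ (Fin 3) → EuclideanSpace ℝ (Fin 3)) (r L η : ℝ),
      ContDiff ℝ (⊤ : ℕ∞) a → VectorCalculus.IsDivFree a → 1 ≤ r → 1 ≤ L → 0 ≤ η →
      (∀ t, r ≤ ‖t‖ → ‖t‖ ≤ r + L → ‖a t‖ ≤ η) →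
      ∀ x : EuclideanSpace ℝ (Fin 3),
        ‖gradient (divPotential fun y => radialCutoff r (r + L) y • a y) x‖ ≤ C * η * (1 + Real.log r) := by
  obtain ⟨CM, hCM, hM2⟩ := exists_norm_gradient_divPotential_cutRef_le
  obtain ⟨Cc, hCc, hcrude⟩ := exists_norm_gradient_divPotential_cutRef_le_crude
  refine ⟨CM + 2 * Cc, by positivity, ?_⟩
  intro a r L η ha hdiv hr hL hη hquiet x
  have hr0 : 0 < r := by linarith
  have hL0 : 0 < L := by linarith
  have hlogr : 0 ≤ Real.log r := Real.log_nonneg hr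
  have hlogL : 0 ≤ Real.log L := Real.log_nonneg hL
  rcases le_or_gt L r with hLr | hrL
  · -- thin collar: the log-sharp M2 bound, `log(r/L) = log r − log L ≤ log r`
    have h := hM2 a r L η ha hdiv hL0 hLr hη hquiet x
    have hlog : Real.log (r / L) ≤ Real.log r := by
      rw [Real.log_div hr0.ne' hL0.ne']; linarith
    calc ‖gradient (divPotential fun y => radialCutoff r (r + L) y • a y) x‖ ≤ CM * η * (1 + Real.log (r / L)) := h
      _ ≤ CM * η * (1 + Real.log r) := by gcongr
      _ ≤ (CM + 2 * Cc) * η * (1 + Real.log r) := by gcongr; linarith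
  · -- fat collar: the crude bound, `(r+L)/L ≤ 2`
    have h := hcrude a r L η ha hdiv hr0 hL0 hη hquiet x
    have hratio : (r + L) / L ≤ 2 := by
      rw [div_le_iff₀ hL0]; linarith
    calc ‖gradient (divPotential fun y => radialCutoff r (r + L) y • a y) x‖ ≤ Cc * η * ((r + L) / L) := h
      _ ≤ Cc * η * 2 := by gcongr
      _ = 2 * Cc * η * 1 := by ring
      _ ≤ 2 * Cc * η * (1 + Real.log r) := by gcongr; linarith
      _ ≤ (CM + 2 * Cc) * η * (1 + Real.log r) := by gcongr; linarith

/-- `(r+L)³ − r³ ≤ 3L(r+L)²` for `0 ≤ r`, `0 ≤ L`. [folklore] -/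
theorem cube_sub_cube_le {r L : ℝ} (hr : 0 ≤ r) (hL : 0 ≤ L) : (r + L) ^ 3 - r ^ 3 ≤ 3 * L * (r + L) ^ 2 := by
  nlinarith [mul_nonneg hr hL, mul_nonneg (mul_nonneg hL hL) hr, mul_nonneg (mul_nonneg hL hL) hL]

/-- **THE FAR FIELD OF THE DATA ERROR (monopole bound)**: there is an absolute `C > 0` such that for every smooth
divergence-free `a`, `η`-quiet on the collar `{r ≤ |t| ≤ r+L}` (`0 < r`, `0 < L`), and every `x` with `‖x‖ ≥ 2(r+L)`,
`‖∇π[χa](x)‖ ≤ C·η·(r+L)²/‖x‖²` (`∂ᵥπ(x) = ∫ ∂ᵥΓ(x−t)·div(χa)(t)dt`, `‖DΓ(x−t)‖ ≤ (4π‖x−t‖²)⁻¹ ≤ (π‖x‖²)⁻¹` on the collar,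
and `∫|div(χa)| ≤ (C₁η/L)·|B₁|·((r+L)³ − r³) ≤ 3|B₁|C₁η(r+L)²`). [folklore] -/
theorem exists_norm_gradient_divPotential_cutRef_far_le :
    ∃ C : ℝ, 0 < C ∧ ∀ (a : EuclideanSpace ℝ (Fin 3) → EuclideanSpace ℝ (Fin 3)) (r L η : ℝ),
      ContDiff ℝ (⊤ : ℕ∞) a → VectorCalculus.IsDivFree a → 0 < r → 0 < L → 0 ≤ η →
      (∀ t, r ≤ ‖t‖ → ‖t‖ ≤ r + L → ‖a t‖ ≤ η) →
      ∀ x : EuclideanSpace ℝ (Fin 3), 2 * (r + L) ≤ ‖x‖ →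
        ‖gradient (divPotential fun y => radialCutoff r (r + L) y • a y) x‖ ≤ C * η * (r + L) ^ 2 / ‖x‖ ^ 2 := by
  obtain ⟨C₁, hC₁, hsrc⟩ := exists_cutRef_source
  set B₁ : ℝ := (volume : Measure (EuclideanSpace ℝ (Fin 3))).real (Metric.ball (0 : EuclideanSpace ℝ (Fin 3)) 1) with hB₁
  have hB₁0 : 0 ≤ B₁ := by rw [hB₁]; exact measureReal_nonneg
  refine ⟨3 * B₁ * C₁ * Real.pi⁻¹ + 1, by positivity, ?_⟩
  intro a r L η ha hdiv hr hL hη hquiet x hx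
  obtain ⟨hG, hGc, -, hD, hsupp⟩ := hsrc a r L η ha hdiv hr hL hη hquiet
  have hR : 0 < r + L := by linarith
  have hxpos : 0 < ‖x‖ := by linarith
  set G : EuclideanSpace ℝ (Fin 3) → EuclideanSpace ℝ (Fin 3) := fun y => radialCutoff r (r + L) y • a y with hGdef
  set σ : EuclideanSpace ℝ (Fin 3) → ℝ := VectorCalculus.divergence G with hσ
  have hσ1 : ContDiff ℝ 1 σ := (contDiff_divergence_of_contDiff_top hG).of_le (by norm_cast)
  have hσc : HasCompactSupport σ := hasCompactSupport_divergence hGc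
  set A : Set (EuclideanSpace ℝ (Fin 3)) := {y | r ≤ ‖y‖ ∧ ‖y‖ ≤ r + L} with hA
  have hAvol : volume A ≤ ENNReal.ofReal ((r + L) ^ 3 - r ^ 3) * volume (Metric.ball (0 : EuclideanSpace ℝ (Fin 3)) 1) :=
    volume_shell_le hr hL
  have hAfin : volume A < ⊤ :=
    lt_of_le_of_lt hAvol (ENNReal.mul_lt_top ENNReal.ofReal_lt_top measure_ball_lt_top)
  have hcube0 : 0 ≤ (r + L) ^ 3 - r ^ 3 :=
    sub_nonneg.2 (pow_le_pow_left₀ hr.le (by linarith) 3)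
  have hAreal : volume.real A ≤ ((r + L) ^ 3 - r ^ 3) * B₁ := by
    have h := ENNReal.toReal_mono (ENNReal.mul_ne_top ENNReal.ofReal_ne_top measure_ball_lt_top.ne) hAvol
    rw [ENNReal.toReal_mul, ENNReal.toReal_ofReal hcube0] at h
    exact h
  -- kernel-gradient representation and the pointwise bound on the collar
  have hrep : ∀ v, fderiv ℝ (divPotential G) x v = ∫ t, fderiv ℝ newtonKernel (x - t) v * σ t := by
    intro v
    rw [show divPotential G = σ ⋆[lsmul ℝ ℝ, volume] newtonKernel from rfl,
      fderiv_convolution_newtonKernel_apply hσ1 hσc x v, convolution_newtonKernel_apply']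
    have h := integral_newtonKernel_smul_fderiv_eq (F := ℝ) hσ1 hσc x v
    simp only [smul_eq_mul] at h
    exact h
  have hker : ∀ v t, t ∈ A → ‖fderiv ℝ newtonKernel (x - t) v * σ t‖ ≤ (Real.pi * ‖x‖ ^ 2)⁻¹ * ‖v‖ * (C₁ / L * η) := by
    intro v t ht
    have hdist : ‖x‖ / 2 ≤ ‖x - t‖ := by
      have := norm_sub_norm_le x t
      have h2 : ‖x‖ - ‖t‖ ≤ ‖x - t‖ := by linarith [abs_norm_sub_norm_le x t, le_abs_self (‖x‖ - ‖t‖)]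
      linarith [ht.2]
    have hxt : 0 < ‖x - t‖ := lt_of_lt_of_le (by positivity) hdist
    have hk : ‖fderiv ℝ newtonKernel (x - t) v‖ ≤ (4 * Real.pi * ‖x - t‖ ^ 2)⁻¹ * ‖v‖ :=
      (le_opNorm _ _).trans (mul_le_mul_of_nonneg_right (norm_fderiv_newtonKernel_le _) (norm_nonneg _))
    have hk2 : (4 * Real.pi * ‖x - t‖ ^ 2)⁻¹ ≤ (Real.pi * ‖x‖ ^ 2)⁻¹ := by
      apply inv_anti₀ (by positivity)
      have hsq : (‖x‖ / 2) ^ 2 ≤ ‖x - t‖ ^ 2 := pow_le_pow_left₀ (by positivity) hdist 2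
      have hsq' : ‖x‖ ^ 2 ≤ 4 * ‖x - t‖ ^ 2 := by nlinarith [hsq]
      have := mul_le_mul_of_nonneg_left hsq' Real.pi_pos.le
      linarith
    rw [norm_mul, Real.norm_eq_abs]
    calc ‖fderiv ℝ newtonKernel (x - t) v‖ * |σ t| ≤ ((Real.pi * ‖x‖ ^ 2)⁻¹ * ‖v‖) * (C₁ / L * η) :=
          mul_le_mul (hk.trans (mul_le_mul_of_nonneg_right hk2 (norm_nonneg _))) (hD t) (abs_nonneg _) (by positivity)
      _ = (Real.pi * ‖x‖ ^ 2)⁻¹ * ‖v‖ * (C₁ / L * η) := by ring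
  have hzero : ∀ v t, t ∉ A → fderiv ℝ newtonKernel (x - t) v * σ t = 0 := by
    intro v t ht
    have : σ t = 0 := by
      by_contra hne
      exact ht (hsupp t hne)
    rw [this, mul_zero]
  have hv : ∀ v, |fderiv ℝ (divPotential G) x v| ≤
      (Real.pi * ‖x‖ ^ 2)⁻¹ * ‖v‖ * (C₁ / L * η) * (((r + L) ^ 3 - r ^ 3) * B₁) := by
    intro v
    rw [hrep v, ← setIntegral_eq_integral_of_forall_compl_eq_zero (s := A) (fun t ht => hzero v t ht), ← Real.norm_eq_abs]
    refine (norm_setIntegral_le_of_norm_le_const hAfin (fun t ht => hker v t ht)).trans ?_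
    exact mul_le_mul_of_nonneg_left hAreal (by positivity)
  have hcube : (r + L) ^ 3 - r ^ 3 ≤ 3 * L * (r + L) ^ 2 := cube_sub_cube_le hr.le hL.le
  have h0 : 0 ≤ (Real.pi * ‖x‖ ^ 2)⁻¹ * (C₁ / L * η) * (((r + L) ^ 3 - r ^ 3) * B₁) := by
    have : 0 ≤ ((r + L) ^ 3 - r ^ 3) * B₁ := mul_nonneg hcube0 hB₁0
    positivity
  rw [norm_gradient_eq_norm_fderiv]
  refine (opNorm_le_bound _ h0 fun v => ?_).trans ?_
  · rw [Real.norm_eq_abs]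
    calc |fderiv ℝ (divPotential G) x v| ≤ (Real.pi * ‖x‖ ^ 2)⁻¹ * ‖v‖ * (C₁ / L * η) * (((r + L) ^ 3 - r ^ 3) * B₁) := hv v
      _ = (Real.pi * ‖x‖ ^ 2)⁻¹ * (C₁ / L * η) * (((r + L) ^ 3 - r ^ 3) * B₁) * ‖v‖ := by ring
  · -- `(π‖x‖²)⁻¹ (C₁η/L) ((r+L)³−r³) B₁ ≤ 3 B₁ C₁ π⁻¹ η (r+L)²/‖x‖²`
    have hx2 : 0 < ‖x‖ ^ 2 := by positivity
    rw [le_div_iff₀ hx2]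
    have step : (Real.pi * ‖x‖ ^ 2)⁻¹ * (C₁ / L * η) * (((r + L) ^ 3 - r ^ 3) * B₁) * ‖x‖ ^ 2 =
        Real.pi⁻¹ * C₁ * η * B₁ * (((r + L) ^ 3 - r ^ 3) / L) := by
      field_simp
    rw [step]
    have hq : ((r + L) ^ 3 - r ^ 3) / L ≤ 3 * (r + L) ^ 2 := by
      rw [div_le_iff₀ hL]; linarith
    calc Real.pi⁻¹ * C₁ * η * B₁ * (((r + L) ^ 3 - r ^ 3) / L) ≤ Real.pi⁻¹ * C₁ * η * B₁ * (3 * (r + L) ^ 2) :=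
          mul_le_mul_of_nonneg_left hq (by positivity)
      _ = (3 * B₁ * C₁ * Real.pi⁻¹) * η * (r + L) ^ 2 := by ring
      _ ≤ (3 * B₁ * C₁ * Real.pi⁻¹ + 1) * η * (r + L) ^ 2 := by gcongr; linarith

/-! ### The `L³` bound and the projected datum -/

/-- **THE `L³` BOUND OF THE DATA ERROR (Riesz transforms)**: there is an absolute `C` such that for every smooth `a` and
`0 ≤ r`, `0 < L`, `‖∇π[χa]‖_{L³} ≤ C·‖1_{B(0,r+L)} a‖_{L³}` and `∇π[χa] ∈ L³` when the right side is finite (tree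
`exists_eLpNorm_gradient_divPotential_le` at `p = 3`, and `|χa| ≤ 1_{B(0,r+L)}|a|`). [folklore] -/
theorem exists_eLpNorm_gradient_divPotential_cutRef_le :
    ∃ C : ℝ≥0, ∀ (a : EuclideanSpace ℝ (Fin 3) → EuclideanSpace ℝ (Fin 3)) (r L : ℝ),
      ContDiff ℝ (⊤ : ℕ∞) a → 0 ≤ r → 0 < L →
      MemLp (fun x => gradient (divPotential fun y => radialCutoff r (r + L) y • a y) x) 3 volume ∧
      eLpNorm (fun x => gradient (divPotential fun y => radialCutoff r (r + L) y • a y) x) 3 volume ≤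
        C * eLpNorm ((Metric.ball (0 : EuclideanSpace ℝ (Fin 3)) (r + L)).indicator a) 3 volume := by
  obtain ⟨C, hC⟩ := exists_eLpNorm_gradient_divPotential_le (p := 3) (by norm_num) (by norm_num)
  refine ⟨C, fun a r L ha hr hL => ?_⟩
  have hrR : r < r + L := by linarith
  have hG : ContDiff ℝ (⊤ : ℕ∞) (fun y => radialCutoff r (r + L) y • a y) := (radialCutoff_contDiff r (r + L)).smul ha
  have hGc : HasCompactSupport (fun y => radialCutoff r (r + L) y • a y) :=
    (hasCompactSupport_radialCutoff hr hrR).smul_right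
  obtain ⟨hmem, hle⟩ := hC _ hG hGc
  refine ⟨hmem, hle.trans (mul_le_mul' le_rfl (eLpNorm_mono fun x => ?_))⟩
  by_cases hx : x ∈ Metric.ball (0 : EuclideanSpace ℝ (Fin 3)) (r + L)
  · rw [Set.indicator_of_mem hx, norm_smul, Real.norm_eq_abs, abs_of_nonneg (radialCutoff_nonneg _ _ _)]
    exact mul_le_of_le_one_left (norm_nonneg _) (radialCutoff_le_one _ _ _)
  · rw [Set.indicator_of_notMem hx, norm_zero]
    rw [Metric.mem_ball, dist_zero_right, not_lt] at hx
    rw [radialCutoff_eq_zero hr hrR hx, zero_smul, norm_zero]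

/-- **OFF `B(0,r+L)` THE PROJECTED DATUM IS A PURE GRADIENT**: `P[χa](x) = −∇π[χa](x)` for `‖x‖ ≥ r+L` (`χ = 0` there).
[folklore] -/
theorem classicalLerayProj_cutRef_eq_neg_gradient {a : EuclideanSpace ℝ (Fin 3) → EuclideanSpace ℝ (Fin 3)} {r L : ℝ}
    (hr : 0 ≤ r) (hL : 0 < L) {x : EuclideanSpace ℝ (Fin 3)} (hx : r + L ≤ ‖x‖) :
    classicalLerayProj (fun y => radialCutoff r (r + L) y • a y) x =
      -gradient (divPotential fun y => radialCutoff r (r + L) y • a y) x := by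
  rw [classicalLerayProj_apply, radialCutoff_eq_zero hr (by linarith) hx, zero_smul, zero_sub]

end Summit.NavierStokesRegularity.NavierStokesRegularity.Cruxes.TypeIQuantSubcubicExp.QuietCollar

end
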